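import Summits.CriticalPhenomena.PercolationContinuityZ3.Theorems.PercNearOneGluingNoHeavyQuantPairFlowAlgebra
import HarnessLib

/-!
# QUANT lane R8, T-DEC: THE PAIR-FLOW CERTIFICATE — for EVERY width `k`, siblings with ARBITRARY gates, opened means and sub-trees satisfy the
# sibling step at the TRUE floor, GIVEN the oracle, as soon as a nonnegative FLOW on the ordered pairs of siblings covers every pair and balances
# every node (a finite LP in `k(k−1)` variables = the exact reach of the boosted dictionary)

builds on p205010 (kernel theorem, internal audit signed; external expert review pending)

Support file (`--supports stmt-CriticalPhenomena-4575`), QUANT lane seat prim-quant-census-1 (gen 27), rung R8 of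
`run/shared/lean/prim/quant/LADDER.md`; memo `run/shared/lean/prim/quant/prim-quant-census-1/g27/PAIRFLOW-G27.md`.  Theorems only, standard axioms,
no sorries; the algebra is part 1, ✓ `…QuantPairFlowAlgebra`.  An INSTANCE, for every width, of ✓ `…QuantSubproductMixture` (`sdec_flaw_of_subproductMix`, p503068); it contains census-1 g26's
✓ `…QuantIdenticalSiblings` (p505337, `k` identical siblings with `(k−1)q ≤ 1`: the uniform flow `s ≡ 1/(2(k−1)q)`) and, at width 3, the cyclic
certificates (✓ p507376, ✓ `…QuantCyclicBoostGeneral`).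

THE REFORMULATION (memo §2).  Siblings `i` with gates `qᵢ ∈ (0,1)`, opened means `mᵢ > 0`; `lᵢ = 1 − qᵢ`; boosted components `Q_{d,j}` = drop `d`, boost `j`
to openness `q_j + q_d m_d / m_j` (gated mean exactly `fmean`; legal iff `q_j m_j + q_d m_d ≤ m_j`), open sets `B` (`|B| ≥ 2`).  Writing the weight of
`Q_{d,j}` as `u_{d,j} = ε · s_{d,j} · l_d l_j q_j m_j / (q_d m_d)`, the mass that the `Q`-components put on a pattern `S` is EXACTLY
    `Σ_{(d,j)} u_{d,j} P_{d,j}(S) = π(S) · ε · Σ_{d ∉ S} ( Σ_{j ≠ d} τ_{d,j} + Σ_{j ∈ S} s_{d,j} )`,   `τ_{d,j} = s_{d,j} q_j (l_j m_j − q_d m_d) / (q_d m_d)`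
(`π` the root-pattern law; the key per-component identity `u_{d,j} P_{d,j}(S) = π(S)·ε·(τ_{d,j} + [j ∈ S] s_{d,j})` for `d ∉ S`).  Hence, with
`ε = 1/(1 + Σ τ)`, the sub-product identity on SINGLETONS is the NODE BALANCE `Σ_d s_{d,a} − Σ_j τ_{a,j} = 1`, i.e.
    (N_a)  `q_a m_a · Σ_{d≠a} s_{d,a} − Σ_{j≠a} s_{a,j} q_j (l_j m_j − q_a m_a) = q_a m_a`,
and the open-set weights `w_S = π(S)(1 − ε R(S))` (`|S| ≥ 2`) are nonnegative because `R(S) = Σ τ + |S| − Σ_{d≠j ∈ S} s_{d,j}` and the PAIR COVERAGE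
    (P_ab) `s_{a,b} + s_{b,a} ≥ 1`
gives `Σ_{d≠j∈S} s_{d,j} ≥ |S|(|S|−1)/2 ≥ |S| − 1`.  So every nonnegative flow `s` with (N) and (P) is a kernel instance of the sibling step (given pairwise
absorbability `q_j m_j + q_d m_d ≤ m_j`, pair means `m_a + m_b ≥ fmean`, and the floor condition `x·Σ mᵢ ≤ fmean·x₁ᵢ`; all automatic for identical
siblings with `(k−1)q ≤ 1`).  (N),(P) is a finite LP; by the 2-cycle decomposition of the memo (§3) it is feasible iff the coverage LP
`z^a_{ab} + z^b_{ab} ≥ 1`, `Σ_b z^a_{ab} c^a_{ab} ≤ 1` is, with closed-form costs `c^a_{ab}`; the HALF rule `z ≡ 1/2` gives the explicit condition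
`Σ_{b≠a} q_b (q_a+q_b)(2−q_a−q_b) / (q_a(1−q_a−q_b)+q_b) ≤ 2` (equal means), which strictly contains `Σq − min q ≤ 1` and `(k−1)q ≤ 1`.

CENSUS (exact rationals, census-1 g27 `code/twocycle.py`, `code/rules.py`, `code/pairflow_general.py`): equal means, all pairwise sums `< 1`: the flow LP
(N),(P) is feasible exactly when the boosted-dictionary LP is (k = 4: 247/247 of 300; k = 5: 60/60 of 150; k = 6: 10/10 of 60; 0 mismatches); the HALF rule
certifies 238 / 50 / 5 of these; `Σq − min q ≤ 1` holds in only 93/200 (k = 4) where the flow LP gives 165/200.  General means: certificate formulas verified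
exactly (singletons, all weights `≥ 0`, component means) on 60/58/19 LP-feasible instances (k = 3/4/5).

* **`sdec_flaw_of_pairFlow`**: `0 < x < 1`; `L` tree-built at `x`, `2 ≤ L.length`; pairwise absorbability; pair means dominate `fmean L`; floor condition;
  a flow `s ≥ 0` with (P) and (N); the oracle below `fgates L` ⟹ `SDEC x (ftop L) (flaw L)`.

HONEST STATUS.  A k-general sub-family of the open core; `SiblingStep` ⟺ `GateStepN`, `UPartStep`, `LightResidDECOracle`, `FarTreeRow` remain OPEN; RATE class
(log\*) and the honest sentence of `run/shared/lean/prim/quant/README.md` unchanged.  [this work]; nothing here is cited as a published result.  The gluing rows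
served [cite: KozmaNitzan2024, Conjecture 3 (p. 15)]; product measure [cite: Grimmett1999, §1.3 p. 10].
-/

noncomputable section

open scoped BigOperators

namespace Summit.CriticalPhenomena.PercolationContinuityZ3.Theorems
namespace Quant
namespace LawDec

open Finset

/-! ### The theorem -/

/-- **THE PAIR-FLOW CERTIFICATE (every width; SDEC form, given the oracle).**  See the module docstring: tree-built siblings `L` (`2 ≤ |L|`) at floor
`x`, pairwise absorbability `q_j m_j + q_d m_d ≤ m_j`, pair means `≥ fmean L`, the floor condition `x·Σ mᵢ ≤ fmean L·x₁ᵢ`, a nonnegative flow `s` on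
ordered pairs with PAIR COVERAGE `s a b + s b a ≥ 1` and NODE BALANCE
`q_a m_a·Σ_{d≠a} s d a − Σ_{j≠a} s a j·q_j((1−q_j)m_j − q_a m_a) = q_a m_a`, and the oracle below `fgates L` ⟹ `SDEC x (ftop L) (flaw L)`. [this work] -/
theorem sdec_flaw_of_pairFlow {x : ℝ} (hx0 : 0 < x) (hx1 : x < 1) (L : List Sib)
    (hL : ∀ t ∈ L, t.TreeOK x) (hn : 2 ≤ L.length)
    (hO : ∀ (x' : ℝ) (n' M' : ℕ) (μ' : ℕ → ℝ), n' < fgates L → TreeBuiltN x' n' M' μ' → SDEC x' M' μ')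
    (hleg : ∀ d j : Fin L.length, d ≠ j →
      (L.get j).q * (L.get j).mean + (L.get d).q * (L.get d).mean ≤ (L.get j).mean)
    (hpair : ∀ a b : Fin L.length, a ≠ b → fmean L ≤ (L.get a).mean + (L.get b).mean)
    (hfl : ∀ i : Fin L.length, x * ∑ l, (L.get l).mean ≤ fmean L * (L.get i).x₁)
    (s : Fin L.length → Fin L.length → ℝ) (hs0 : ∀ d j, 0 ≤ s d j)
    (hcov : ∀ a b : Fin L.length, a ≠ b → 1 ≤ s a b + s b a)
    (hnode : ∀ a : Fin L.length,
      (L.get a).q * (L.get a).mean * ∑ d ∈ Finset.univ.erase a, s d a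
        - ∑ j ∈ Finset.univ.erase a, s a j * ((L.get j).q * ((1 - (L.get j).q) * (L.get j).mean - (L.get a).q * (L.get a).mean))
        = (L.get a).q * (L.get a).mean) :
    SDEC x (ftop L) (flaw L) := by
  classical
  have hget : ∀ i : Fin L.length, (L.get i).TreeOK x := fun i => hL _ (List.get_mem L i)
  have hL' : ∀ t ∈ L, t.LawOK := fun t ht => (hL t ht).lawOK
  -- shorthands
  set q : Fin L.length → ℝ := fun i => (L.get i).q with hqdef
  set m : Fin L.length → ℝ := fun i => (L.get i).mean with hmdef
  set y : Fin L.length → ℝ := fun i => (L.get i).x₁ with hydef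
  have hq0 : ∀ i, 0 < q i := fun i => (hget i).1
  have hq1 : ∀ i, q i < 1 := fun i => (hget i).2.1
  have hxq : ∀ i, x ≤ q i * y i := fun i => (hget i).2.2.1
  have hm0 : ∀ i, 0 < m i := fun i => (L.get i).mean_pos (hget i)
  have hy0 : ∀ i, 0 < y i := fun i => by
    obtain ⟨_, _, _, hT, _⟩ := hget i
    exact hT.lawFacts.1
  have hne : L ≠ [] := by
    intro h; have h' := congrArg List.length h; simp only [List.length_nil] at h'; omega
  have hfm : fmean L = ∑ i, q i * m i := fmean_eq_sum_get L
  have hfm0 : 0 < fmean L := fmean_pos_of_ne_nil L hL' hm0 hne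
  set Mtot : ℝ := ∑ i, m i with hMtot
  have hMtot0 : 0 < Mtot := Finset.sum_pos (fun i _ => hm0 i) ⟨⟨0, by omega⟩, Finset.mem_univ _⟩
  -- the flow data
  set τ : Fin L.length → Fin L.length → ℝ := fun d j => s d j * (q j * ((1 - q j) * m j - q d * m d)) / (q d * m d) with hτdef
  set out : Fin L.length → ℝ := fun d => ∑ j ∈ Finset.univ.erase d, τ d j with houtdef
  set inn : Fin L.length → ℝ := fun a => ∑ d ∈ Finset.univ.erase a, s d a with hinndef
  set T : ℝ := ∑ d, out d with hTdef
  have hτ0 : ∀ d j, d ≠ j → 0 ≤ τ d j := by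
    intro d j hdj
    have h1 : 0 ≤ (1 - q j) * m j - q d * m d := by have := hleg d j hdj; show 0 ≤ (1 - (L.get j).q) * (L.get j).mean - (L.get d).q * (L.get d).mean; linarith
    exact div_nonneg (mul_nonneg (hs0 d j) (mul_nonneg (hq0 j).le h1)) (mul_pos (hq0 d) (hm0 d)).le
  have hout0 : ∀ d, 0 ≤ out d := fun d => Finset.sum_nonneg fun j hj => hτ0 d j (Finset.ne_of_mem_erase hj).symm
  have hT0 : 0 ≤ T := Finset.sum_nonneg fun d _ => hout0 d
  set ε : ℝ := 1 / (1 + T) with hεdef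
  have hε0 : 0 < ε := by rw [hεdef]; positivity
  have hεT : ε * (1 + T) = 1 := by rw [hεdef]; field_simp
  -- node balance in flow form: `inn a = 1 + out a`
  have hinout : ∀ a, inn a = 1 + out a := by
    intro a
    have hqm : 0 < q a * m a := mul_pos (hq0 a) (hm0 a)
    have hout : out a * (q a * m a) = ∑ j ∈ Finset.univ.erase a, s a j * (q j * ((1 - q j) * m j - q a * m a)) := by
      rw [houtdef]; simp only
      rw [Finset.sum_mul]
      exact Finset.sum_congr rfl fun j _ => div_mul_cancel₀ _ hqm.ne'
    have h := hnode a
    have h' : q a * m a * inn a - out a * (q a * m a) = q a * m a := by rw [hout]; exact h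
    have h'' : q a * m a * (inn a - out a - 1) = 0 := by linarith
    rcases mul_eq_zero.1 h'' with h0 | h0
    · exact absurd h0 hqm.ne'
    · linarith
  -- the certificate data
  set PQ : Finset (Fin L.length × Fin L.length) := (Finset.univ : Finset (Fin L.length × Fin L.length)).filter fun p => p.1 ≠ p.2 with hPQ
  set PO : Finset (Finset (Fin L.length)) := (Finset.univ : Finset (Finset (Fin L.length))).filter fun B => 2 ≤ B.card with hPO
  set S : Finset ((Fin L.length × Fin L.length) ⊕ Finset (Fin L.length)) := PQ.image Sum.inl ∪ PO.image Sum.inr with hS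
  set uQ : Fin L.length × Fin L.length → ℝ := fun p => ε * (s p.1 p.2 * ((1 - q p.1) * (1 - q p.2) * q p.2 * m p.2)) / (q p.1 * m p.1) with huQ
  set oQ : Fin L.length × Fin L.length → Fin L.length → ℝ := fun p i => if i = p.2 then q p.2 + q p.1 * m p.1 / m p.2 else q i with hoQ
  set PP : Fin L.length × Fin L.length → Finset (Fin L.length) → ℝ := fun p B =>
    if B ⊆ Finset.univ.erase p.1 then (∏ i ∈ B, oQ p i) * ∏ i ∈ Finset.univ.erase p.1 \ B, (1 - oQ p i) else 0 with hPP
  set piB : Finset (Fin L.length) → ℝ := fun B => (∏ i ∈ B, q i) * ∏ i ∈ Finset.univ \ B, (1 - q i) with hpiB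
  set Rh : Finset (Fin L.length) → ℝ := fun B =>
    ∑ p ∈ PQ, (if p.1 ∈ B then 0 else τ p.1 p.2 + if p.2 ∈ B then s p.1 p.2 else 0) with hRh
  set uO : Finset (Fin L.length) → ℝ := fun B => piB B - ∑ p ∈ PQ, uQ p * PP p B with huO
  set u : (Fin L.length × Fin L.length) ⊕ Finset (Fin L.length) → ℝ := Sum.elim uQ uO with hu
  set E : (Fin L.length × Fin L.length) ⊕ Finset (Fin L.length) → Finset (Fin L.length) := Sum.elim (fun p => Finset.univ.erase p.1) (fun B => B) with hE
  set o : (Fin L.length × Fin L.length) ⊕ Finset (Fin L.length) → Fin L.length → ℝ := Sum.elim oQ (fun _ _ => 1) with ho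
  set v : (Fin L.length × Fin L.length) ⊕ Finset (Fin L.length) → ℝ := Sum.elim (fun _ => x) (fun _ => x * Mtot / fmean L) with hv
  have hpiB0 : ∀ B, 0 ≤ piB B := fun B =>
    mul_nonneg (Finset.prod_nonneg fun i _ => (hq0 i).le) (Finset.prod_nonneg fun i _ => by linarith [hq1 i])
  -- membership in `S` and sums over `S`, `PQ`
  have hcase : ∀ c ∈ S, (∃ d j : Fin L.length, d ≠ j ∧ c = Sum.inl (d, j)) ∨ (∃ B : Finset (Fin L.length), 2 ≤ B.card ∧ c = Sum.inr B) := by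
    intro c hc
    rcases Finset.mem_union.1 hc with h | h
    · obtain ⟨p, hp, rfl⟩ := Finset.mem_image.1 h
      exact Or.inl ⟨p.1, p.2, (Finset.mem_filter.1 hp).2, rfl⟩
    · obtain ⟨B, hB, rfl⟩ := Finset.mem_image.1 h
      exact Or.inr ⟨B, (Finset.mem_filter.1 hB).2, rfl⟩
  have hsumS : ∀ f : (Fin L.length × Fin L.length) ⊕ Finset (Fin L.length) → ℝ,
      ∑ c ∈ S, f c = ∑ p ∈ PQ, f (Sum.inl p) + ∑ B ∈ PO, f (Sum.inr B) := by
    intro f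
    rw [hS, Finset.sum_union, Finset.sum_image (fun a _ b _ h => Sum.inl_injective h),
      Finset.sum_image (fun a _ b _ h => Sum.inr_injective h)]
    rw [Finset.disjoint_left]
    intro c hc hc'
    obtain ⟨p, _, rfl⟩ := Finset.mem_image.1 hc
    obtain ⟨B, _, h⟩ := Finset.mem_image.1 hc'
    exact Sum.inr_ne_inl h
  have hPQsum : ∀ f : Fin L.length × Fin L.length → ℝ, ∑ p ∈ PQ, f p = ∑ d, ∑ j ∈ Finset.univ.erase d, f (d, j) := by
    intro f
    rw [hPQ, Finset.sum_filter, ← Finset.univ_product_univ, Finset.sum_product]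
    refine Finset.sum_congr rfl fun d _ => ?_
    rw [← Finset.sum_filter]
    refine Finset.sum_congr ?_ fun j _ => rfl
    ext j; simp [Finset.mem_erase, eq_comm]
  -- THE KEY PER-COMPONENT IDENTITY (lemma `pairFlow_component_mass`)
  have hkey : ∀ p ∈ PQ, ∀ B : Finset (Fin L.length),
      uQ p * PP p B = piB B * (ε * (if p.1 ∈ B then 0 else τ p.1 p.2 + if p.2 ∈ B then s p.1 p.2 else 0)) := by
    intro p hp B
    obtain ⟨d, j⟩ := p
    have hdj : d ≠ j := (Finset.mem_filter.1 hp).2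
    simp only
    by_cases hd : d ∈ B
    · have hnot : ¬ B ⊆ Finset.univ.erase d := fun h => (Finset.mem_erase.1 (h hd)).1 rfl
      rw [if_pos hd]
      show _ * (if B ⊆ Finset.univ.erase d then _ else 0) = _
      rw [if_neg hnot]; ring
    have hsub : B ⊆ Finset.univ.erase d :=
      fun i hi => Finset.mem_erase.2 ⟨fun (h : i = d) => hd (h ▸ hi), Finset.mem_univ i⟩
    rw [if_neg hd]
    show ε * (s d j * ((1 - q d) * (1 - q j) * q j * m j)) / (q d * m d) *
        (if B ⊆ Finset.univ.erase d then (∏ i ∈ B, (if i = j then q j + q d * m d / m j else q i)) *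
          ∏ i ∈ Finset.univ.erase d \ B, (1 - (if i = j then q j + q d * m d / m j else q i)) else 0)
      = ((∏ i ∈ B, q i) * ∏ i ∈ Finset.univ \ B, (1 - q i)) *
        (ε * (s d j * (q j * ((1 - q j) * m j - q d * m d)) / (q d * m d) + if j ∈ B then s d j else 0))
    rw [if_pos hsub]
    exact pairFlow_component_mass q m s ε d j hdj (hq0 d).ne' (hm0 d).ne' (hm0 j).ne' B hd
  -- hence the total `Q`-mass on a pattern
  have hQsum : ∀ B : Finset (Fin L.length), ∑ p ∈ PQ, uQ p * PP p B = piB B * (ε * Rh B) := by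
    intro B
    rw [hRh]; simp only
    rw [Finset.mul_sum, Finset.mul_sum]
    exact Finset.sum_congr rfl fun p hp => hkey p hp B
  have hinout' : ∀ a, ∑ d ∈ Finset.univ.erase a, s d a = 1 + ∑ j ∈ Finset.univ.erase a, τ a j :=
    fun a => hinout a
  -- `Rh` on a singleton: `T + 1`
  have hRh1 : ∀ a : Fin L.length, Rh {a} = 1 + T := by
    intro a
    rw [hRh]; simp only
    rw [hPQsum]
    exact pairFlow_ratio_singleton τ s hinout' a
  -- `Rh` on a set with at least two elements: `≤ T + 1`
  have hRh2 : ∀ B : Finset (Fin L.length), 2 ≤ B.card → Rh B ≤ 1 + T := by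
    intro B hB
    rw [hRh]; simp only
    rw [hPQsum]
    exact pairFlow_ratio_le τ s hinout' hcov B hB
  -- gated means of the components
  have hmeanQ : ∀ d j : Fin L.length, d ≠ j → fmean (subRegate L (Finset.univ.erase d) (oQ (d, j))) = fmean L := by
    intro d j hdj
    rw [fmean_subRegate, hfm]
    show ∑ i ∈ Finset.univ.erase d, (if i = j then q j + q d * m d / m j else q i) * (L.get i).mean = ∑ i, q i * m i
    have e : ∀ i ∈ Finset.univ.erase d, (if i = j then q j + q d * m d / m j else q i) * (L.get i).mean
        = q i * m i + (if i = j then q d * m d / m j * m j else 0) := by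
      intro i _
      show (if i = j then q j + q d * m d / m j else q i) * m i = _
      split_ifs with h
      · subst h; ring
      · ring
    rw [Finset.sum_congr rfl e, Finset.sum_add_distrib, Finset.sum_ite_eq' (Finset.univ.erase d) j,
      if_pos (Finset.mem_erase.2 ⟨hdj.symm, Finset.mem_univ j⟩), div_mul_cancel₀ _ (hm0 j).ne',
      ← Finset.add_sum_erase Finset.univ (fun i => q i * m i) (Finset.mem_univ d)]
    ring
  have hmeanO : ∀ B : Finset (Fin L.length), fmean (subRegate L B (fun _ => (1 : ℝ))) = ∑ i ∈ B, m i := by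
    intro B; rw [fmean_subRegate_one]
  -- weights of the open sets are nonnegative
  have huO0 : ∀ B : Finset (Fin L.length), 2 ≤ B.card → 0 ≤ uO B := by
    intro B hB
    show 0 ≤ piB B - ∑ p ∈ PQ, uQ p * PP p B
    rw [hQsum B]
    have h1 : ε * Rh B ≤ 1 := by
      calc ε * Rh B ≤ ε * (1 + T) := mul_le_mul_of_nonneg_left (hRh2 B hB) hε0.le
        _ = 1 := hεT
    nlinarith [hpiB0 B]
  refine sdec_flaw_of_subproductMix hx0 hx1 L hL hne hO S u E o ?_ ?_ ?_ ?_ ?_ v ?_ ?_ ?_ ?_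
  · -- `0 ≤ u`
    intro c hc
    rcases hcase c hc with ⟨d, j, hdj, rfl⟩ | ⟨B, hB, rfl⟩
    · show 0 ≤ ε * (s d j * ((1 - q d) * (1 - q j) * q j * m j)) / (q d * m d)
      have := hq1 d; have := hq1 j
      exact div_nonneg (mul_nonneg hε0.le (mul_nonneg (hs0 d j)
        (mul_nonneg (mul_nonneg (mul_nonneg (by linarith) (by linarith)) (hq0 j).le) (hm0 j).le))) (mul_pos (hq0 d) (hm0 d)).le
    · exact huO0 B hB
  · -- `0 < o`
    intro c hc i hi
    rcases hcase c hc with ⟨d, j, hdj, rfl⟩ | ⟨B, hB, rfl⟩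
    · show 0 < (if i = j then q j + q d * m d / m j else q i)
      split_ifs
      · exact add_pos (hq0 j) (div_pos (mul_pos (hq0 d) (hm0 d)) (hm0 j))
      · exact hq0 i
    · show (0 : ℝ) < 1; exact one_pos
  · -- `o ≤ 1`
    intro c hc i hi
    rcases hcase c hc with ⟨d, j, hdj, rfl⟩ | ⟨B, hB, rfl⟩
    · show (if i = j then q j + q d * m d / m j else q i) ≤ 1
      split_ifs
      · have h := hleg d j hdj
        have h' : (q j + q d * m d / m j) * m j ≤ 1 * m j := by
          rw [add_mul, div_mul_cancel₀ _ (hm0 j).ne', one_mul]; exact h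
        exact le_of_mul_le_mul_right h' (hm0 j)
      · exact (hq1 i).le
    · show (1 : ℝ) ≤ 1; exact le_rfl
  · -- legality
    intro c hc
    rcases hcase c hc with ⟨d, j, hdj, rfl⟩ | ⟨B, hB, rfl⟩
    · exact ⟨d, Or.inl (show d ∉ Finset.univ.erase d from fun h => (Finset.mem_erase.1 h).1 rfl)⟩
    · exact ⟨⟨0, by omega⟩, Or.inr rfl⟩
  · -- THE PATTERN IDENTITY
    intro A hA
    have hget' : ((∏ i ∈ A, (L.get i).q) * ∏ i ∈ Finset.univ \ A, (1 - (L.get i).q)) = piB A := rfl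
    rw [hget', hsumS]
    -- the O part: only `B = A` contributes
    have hOpart : ∑ B ∈ PO, u (Sum.inr B) *
        (if A ⊆ E (Sum.inr B) then (∏ i ∈ A, o (Sum.inr B) i) * ∏ i ∈ E (Sum.inr B) \ A, (1 - o (Sum.inr B) i) else 0)
        = if 2 ≤ A.card then uO A else 0 := by
      have term : ∀ B ∈ PO, u (Sum.inr B) *
          (if A ⊆ E (Sum.inr B) then (∏ i ∈ A, o (Sum.inr B) i) * ∏ i ∈ E (Sum.inr B) \ A, (1 - o (Sum.inr B) i) else 0)
          = if B = A then uO A else 0 := by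
        intro B _
        show uO B * (if A ⊆ B then (∏ i ∈ A, (1 : ℝ)) * ∏ i ∈ B \ A, (1 - (1 : ℝ)) else 0) = _
        by_cases hBA : B = A
        · rw [hBA, if_pos (Finset.Subset.refl A), if_pos rfl, Finset.sdiff_self, Finset.prod_empty, Finset.prod_const_one]
          ring
        · rw [if_neg hBA]
          by_cases hAB : A ⊆ B
          · obtain ⟨i, hi⟩ : (B \ A).Nonempty := by
              rw [Finset.sdiff_nonempty]; intro hBA'; exact hBA (Finset.Subset.antisymm hBA' hAB)
            rw [if_pos hAB, Finset.prod_eq_zero hi (by norm_num), mul_zero, mul_zero]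
          · rw [if_neg hAB, mul_zero]
      rw [Finset.sum_congr rfl term, Finset.sum_ite_eq']
      by_cases h2 : 2 ≤ A.card
      · have hmemA : A ∈ PO := Finset.mem_filter.2 ⟨Finset.mem_univ A, h2⟩
        rw [if_pos hmemA, if_pos h2]
      · have hmemA : A ∉ PO := fun h => h2 (Finset.mem_filter.1 h).2
        rw [if_neg hmemA, if_neg h2]
    rw [hOpart]
    have hQpart : ∑ p ∈ PQ, u (Sum.inl p) *
        (if A ⊆ E (Sum.inl p) then (∏ i ∈ A, o (Sum.inl p) i) * ∏ i ∈ E (Sum.inl p) \ A, (1 - o (Sum.inl p) i) else 0)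
        = ∑ p ∈ PQ, uQ p * PP p A := rfl
    rw [hQpart]
    by_cases h2 : 2 ≤ A.card
    · rw [if_pos h2]
      show ∑ p ∈ PQ, uQ p * PP p A + (piB A - ∑ p ∈ PQ, uQ p * PP p A) = piB A
      ring
    · rw [if_neg h2, add_zero, hQsum A]
      have hc1 : A.card = 1 := le_antisymm (Nat.lt_succ_iff.1 (Nat.lt_of_not_le h2)) (Finset.card_pos.2 hA)
      obtain ⟨a, ha⟩ : ∃ a, A = {a} := Finset.card_eq_one.1 hc1
      rw [ha, hRh1 a, hεT, mul_one]
  · -- `0 < v`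
    intro c hc
    rcases hcase c hc with ⟨d, j, hdj, rfl⟩ | ⟨B, hB, rfl⟩
    · exact hx0
    · show 0 < x * Mtot / fmean L; positivity
  · -- `v ≤ o i · x₁`
    intro c hc i hi
    rcases hcase c hc with ⟨d, j, hdj, rfl⟩ | ⟨B, hB, rfl⟩
    · show x ≤ (if i = j then q j + q d * m d / m j else q i) * (L.get i).x₁
      split_ifs with h
      · subst h
        have h1 : 0 ≤ q d * m d / m i * y i := by have := hy0 i; have := hq0 d; have := hm0 d; have := hm0 i; positivity
        calc x ≤ q i * y i := hxq i
          _ ≤ (q i + q d * m d / m i) * y i := by rw [add_mul]; linarith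
      · exact hxq i
    · show x * Mtot / fmean L ≤ 1 * (L.get i).x₁
      rw [one_mul, div_le_iff₀ hfm0]
      calc x * Mtot ≤ fmean L * (L.get i).x₁ := hfl i
        _ = (L.get i).x₁ * fmean L := mul_comm _ _
  · -- floors do not bind
    intro c hc
    rcases hcase c hc with ⟨d, j, hdj, rfl⟩ | ⟨B, hB, rfl⟩
    · show x * fmean (subRegate L (Finset.univ.erase d) (oQ (d, j))) ≤ fmean L * x
      rw [hmeanQ d j hdj, mul_comm]
    · show x * fmean (subRegate L B (fun _ => (1 : ℝ))) ≤ fmean L * (x * Mtot / fmean L)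
      rw [hmeanO B, mul_div_assoc', mul_div_cancel_left₀ _ hfm0.ne']
      exact mul_le_mul_of_nonneg_left (Finset.sum_le_univ_sum_of_nonneg fun i => (hm0 i).le) hx0.le
  · -- means dominate
    intro c hc
    rcases hcase c hc with ⟨d, j, hdj, rfl⟩ | ⟨B, hB, rfl⟩
    · show fmean L ≤ fmean (subRegate L (Finset.univ.erase d) (oQ (d, j)))
      rw [hmeanQ d j hdj]
    · show fmean L ≤ fmean (subRegate L B (fun _ => (1 : ℝ)))
      rw [hmeanO B]
      obtain ⟨a, ha, b, hb, hab⟩ := Finset.one_lt_card.1 (by omega : 1 < B.card)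
      have hsub : ({a, b} : Finset (Fin L.length)) ⊆ B := by
        intro i hi
        rcases Finset.mem_insert.1 hi with rfl | hi
        · exact ha
        · rw [Finset.mem_singleton.1 hi]; exact hb
      calc fmean L ≤ m a + m b := hpair a b hab
        _ = ∑ i ∈ ({a, b} : Finset (Fin L.length)), m i := (Finset.sum_pair hab).symm
        _ ≤ ∑ i ∈ B, m i := Finset.sum_le_sum_of_subset_of_nonneg hsub fun i _ _ => (hm0 i).le

end LawDec
end Quant
end Summit.CriticalPhenomena.PercolationContinuityZ3.Theorems
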